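/-
Copyright (c) 2026 The h413 squad. All rights reserved.
Released under Apache 2.0 license as described in the file LICENSE.
Authors: K2E3-p14 (g3), (SC-an) line lead
-/
import Summits.HodgeConjecture.HodgeConjecture.Theorems.K2E3SupercuspBallBoundSplitAssembly   -- ★ (M5e-1): model frame, `normAbs`, `unitaryGroupOfForm` (brings Haar ∕ lintegral API)
import Literature.NumberTheory.Rogawski1990.LocalTransfer                                   -- ★ `IsRegularElt` (separable characteristic polynomial)
import HarnessLib

/-!
# K2_E3 road (h413), (SC-an) domination cone, road «HC-14-ell»: FROM LOCAL-UNIFORM TO UNIFORM — THE GLUE (RULINGS #11 (R11-1) in bytes)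

Harish-Chandra's Theorem 13 ([HarishChandra1970] Part V §3 p. 44) is a statement about a COMPACT set `ω ⊆ 𝔤` and ALL regular elements of `ω` at once; its proof is
organised by POINTS of `ω` (descent at each `X₁ ∈ ω`), not by Cartan subalgebras.  For the compact Cartans of the road «HC-14-ell» the orbital integral is a plain Haar
integral `Φ_Θ(X) = ∫_U Θ(g • X) dμ(g)` with ONE right-invariant `μ`, so the passage «local-uniform near every point of the support `S` ⇒ uniform over ALL admissible
`X`» is two soft steps: (s1) if the orbit of `X` misses `S` the integral vanishes, otherwise `X` is conjugate INTO `S` and everything in sight is conjugation invariant;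
(s2) `S` is compact, so finitely many neighbourhoods suffice.  This file types exactly that, ABSTRACTLY (§1: any group `G` with a right-invariant measure acting on
any space `𝔛` through `act`, any invariant weight `w` and invariant admissibility predicate `P`) and for the ADJOINT ACTION of `U = ↥(unitaryGroupOfForm σ J)` on
`M_n(K)` (§2: the action law, invariance of `𝔲(σ,J)`-membership, of the characteristic polynomial, and of compactness of the centraliser; §3: the glue in the currency
of the lead's cand `sig_K2E3HC13LieEllRankOne` — every `n`, every `J`).

* §1 `lintegral_act_act_eq` (`∫ Θ(g • (h • X)) = ∫ Θ(g • X)`), `exists_const_of_forall_exists_nhds` (THE GLUE).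
* §2 `conjAct_mul` (action law), `mem_lieU_conjAct` (`X ∈ 𝔲 ⇒ hXh⁻¹ ∈ 𝔲`), `charpoly_conjAct`, `isCompact_centralizerSet_conjAct`.
* §3 `hc13Lie_uniform_of_local`: local-uniform bounds at every point of `S` ⇒ the uniform letter's conclusion, verbatim bytes of the cand (any `n`, `J`).

HC_CM is proved only modulo the printed citations; count-neutral helper (road HC-14-ell bookkeeping; the E-pieces prove the local statements).
-/

set_option autoImplicit false
set_option linter.dupNamespace false

noncomputable section

open MeasureTheory Measure Set Filter Topology
open scoped NNReal ENNReal MatrixGroups WithZero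
open Literature.NumberTheory.Automorphic Literature.NumberTheory.Automorphic.UnitaryGroup
open Literature.NumberTheory.GaloisRepresentations Literature.NumberTheory.GaloisRepresentations.IsNonarchimedeanLocalField

namespace Summit.HodgeConjecture.HodgeConjecture.Cruxes.H413.K2E3HC14EllLocalToUniform

/-! ## §1 The abstract glue -/

section Abstract

variable {G 𝔛 : Type*} [Group G] [MeasurableSpace G] [MeasurableMul G] (μ : Measure G) [μ.IsMulRightInvariant]
  (act : G → 𝔛 → 𝔛) (hact : ∀ g h X, act (g * h) X = act g (act h X))

include hact in
/-- **Orbital integrals are orbit invariants**: `∫ Θ(g • (h • X)) dμ(g) = ∫ Θ(g • X) dμ(g)` for a right-invariant `μ` (substitute `g ↦ g h`).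
[cite: HarishChandra1970, Part V §3 p. 44] -/
theorem lintegral_act_act_eq (Θ : 𝔛 → ℝ≥0∞) (h : G) (X : 𝔛) : ∫⁻ g, Θ (act g (act h X)) ∂μ = ∫⁻ g, Θ (act g X) ∂μ := by
  simp_rw [← hact]
  exact lintegral_mul_right_eq_self (fun g => Θ (act g X)) h

variable [TopologicalSpace 𝔛]

include hact in
/-- **THE GLUE — LOCAL-UNIFORM AT EVERY POINT OF THE SUPPORT ⇒ UNIFORM.**  Let `w : 𝔛 → [0,∞]` (the token) and `P` (admissibility: «regular elliptic in `𝔲`») be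
invariant under the action, `S ⊆ 𝔛` compact.  If every `X₁ ∈ S` has a neighbourhood `V` and a constant `C` with `w(X) · ∫ Θ(g • X) dμ ≤ C · M` for all admissible
`X ∈ V` and all `Θ` vanishing off `S` bounded by `M`, then ONE constant serves ALL admissible `X`: either the orbit of `X` misses `S` (the integral is `0`) or
`g₀ • X ∈ S` lies in one of finitely many `V`'s and the bound transports back along `g₀`.  [cite: HarishChandra1970, Part V §3 Theorem 13 p. 44; Part VI §8 p. 60] -/
theorem exists_const_of_forall_exists_nhds {w : 𝔛 → ℝ≥0∞} (hw : ∀ (g : G) (X : 𝔛), w (act g X) = w X) {P : 𝔛 → Prop} (hP : ∀ (g : G) (X : 𝔛), P X → P (act g X))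
    {S : Set 𝔛} (hS : IsCompact S)
    (hloc : ∀ X₁ ∈ S, ∃ V ∈ 𝓝 X₁, ∃ C : ℝ≥0, ∀ Θ : 𝔛 → ℝ≥0∞, (∀ X, Θ X ≠ 0 → X ∈ S) → ∀ M : ℝ≥0∞, (∀ X, Θ X ≤ M) →
      ∀ X ∈ V, P X → w X * ∫⁻ g, Θ (act g X) ∂μ ≤ C * M) :
    ∃ C : ℝ≥0, ∀ Θ : 𝔛 → ℝ≥0∞, (∀ X, Θ X ≠ 0 → X ∈ S) → ∀ M : ℝ≥0∞, (∀ X, Θ X ≤ M) →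
      ∀ X, P X → w X * ∫⁻ g, Θ (act g X) ∂μ ≤ C * M := by
  classical
  choose! V hV C hC using hloc
  obtain ⟨t, hcover⟩ := hS.elim_nhds_subcover' (fun x _ => V x) fun x hx => hV x hx
  refine ⟨t.sup fun x => C (x : 𝔛), fun Θ hΘ M hM X hX => ?_⟩
  by_cases hzero : ∀ g : G, Θ (act g X) = 0
  · simp [hzero]
  push Not at hzero
  obtain ⟨g₀, hg₀⟩ := hzero
  have hmem : act g₀ X ∈ S := hΘ _ hg₀
  have hU : act g₀ X ∈ ⋃ x ∈ t, V (x : 𝔛) := hcover hmem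
  rw [Set.mem_iUnion₂] at hU
  obtain ⟨x, hx, hxV⟩ := hU
  have hb := hC (x : 𝔛) x.2 Θ hΘ M hM (act g₀ X) hxV (hP g₀ X hX)
  rw [hw, lintegral_act_act_eq μ act hact] at hb
  refine hb.trans (mul_le_mul' ?_ le_rfl)
  have hle : C (x : 𝔛) ≤ t.sup fun x => C (x : 𝔛) := Finset.le_sup (f := fun x : ↥S => C (x : 𝔛)) hx
  exact ENNReal.coe_le_coe.2 hle

end Abstract

/-! ## §2 The adjoint action of `U(σ, J)` on `M_n(K)` and its invariants -/

section Adjoint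

variable {K : Type*} [Field K] (σ : K →+* K) {n : ℕ} {J : Matrix (Fin n) (Fin n) K}

/-- The action law of `(g, X) ↦ g X g⁻¹` on `M_n(K)` for `g ∈ U(σ,J) ≤ GL_n(K)`. [cite: HarishChandra1970, Part V §1 p. 40] -/
theorem conjAct_mul (g h : ↥(unitaryGroupOfForm σ J)) (X : Matrix (Fin n) (Fin n) K) :
    (((g * h : ↥(unitaryGroupOfForm σ J)) : GL (Fin n) K) : Matrix (Fin n) (Fin n) K) * X *
        ((((g * h : ↥(unitaryGroupOfForm σ J))⁻¹ : ↥(unitaryGroupOfForm σ J)) : GL (Fin n) K) : Matrix (Fin n) (Fin n) K) =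
      ((g : GL (Fin n) K) : Matrix (Fin n) (Fin n) K) *
          (((h : GL (Fin n) K) : Matrix (Fin n) (Fin n) K) * X * (((h⁻¹ : ↥(unitaryGroupOfForm σ J)) : GL (Fin n) K) : Matrix (Fin n) (Fin n) K)) *
        (((g⁻¹ : ↥(unitaryGroupOfForm σ J)) : GL (Fin n) K) : Matrix (Fin n) (Fin n) K) := by
  simp only [_root_.mul_inv_rev, Subgroup.coe_mul, InvMemClass.coe_inv, Units.val_mul, Matrix.mul_assoc]

/-- **`𝔲(σ, J)` is `Ad(U)`-stable**: if `(σX)ᵀ J + J X = 0` and `h ∈ U(σ, J)` (`(σh)ᵀ J h = J`) then `(σ(hXh⁻¹))ᵀ J + J (hXh⁻¹) = 0` — with `(σh)ᵀ J = J h⁻¹` and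
`J h = ((σh)ᵀ)⁻¹ J` the left side is `((σh)ᵀ)⁻¹ ((σX)ᵀ J + J X) h⁻¹`. [cite: HarishChandra1970, Part V §1 p. 40] [cite: Rogawski1990, §1.9 p. 8] -/
theorem mem_lieU_conjAct (h : ↥(unitaryGroupOfForm σ J)) {X : Matrix (Fin n) (Fin n) K} (hX : (X.map σ).transpose * J + J * X = 0) :
    ((((h : GL (Fin n) K) : Matrix (Fin n) (Fin n) K) * X * (((h⁻¹ : ↥(unitaryGroupOfForm σ J)) : GL (Fin n) K) : Matrix (Fin n) (Fin n) K)).map σ).transpose * J +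
      J * (((h : GL (Fin n) K) : Matrix (Fin n) (Fin n) K) * X * (((h⁻¹ : ↥(unitaryGroupOfForm σ J)) : GL (Fin n) K) : Matrix (Fin n) (Fin n) K)) = 0 := by
  set H : Matrix (Fin n) (Fin n) K := ((h : GL (Fin n) K) : Matrix (Fin n) (Fin n) K) with hHdef
  set Hi : Matrix (Fin n) (Fin n) K := (((h⁻¹ : ↥(unitaryGroupOfForm σ J)) : GL (Fin n) K) : Matrix (Fin n) (Fin n) K) with hHidef
  have hHiH : Hi * H = 1 := by
    rw [hHidef, hHdef, InvMemClass.coe_inv, Matrix.coe_units_inv, Matrix.nonsing_inv_mul _ (Matrix.isUnits_det_units _)]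
  have hHHi : H * Hi = 1 := by
    rw [hHidef, hHdef, InvMemClass.coe_inv, Matrix.coe_units_inv, Matrix.mul_nonsing_inv _ (Matrix.isUnits_det_units _)]
  have hunit : (H.map σ).transpose * J * H = J := mem_unitaryGroupOfForm_iff.1 h.2
  -- `σ`-images
  have hmapHiH : Hi.map σ * H.map σ = 1 := by rw [← Matrix.map_mul, hHiH, Matrix.map_one _ (map_zero σ) (map_one σ)]
  have hmapHHi : H.map σ * Hi.map σ = 1 := by rw [← Matrix.map_mul, hHHi, Matrix.map_one _ (map_zero σ) (map_one σ)]
  -- `(σh)ᵀ J = J h⁻¹` and `J h = (σ h⁻¹)ᵀ J`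
  have h1 : (H.map σ).transpose * J = J * Hi := by
    calc (H.map σ).transpose * J = (H.map σ).transpose * J * (H * Hi) := by rw [hHHi, Matrix.mul_one]
      _ = ((H.map σ).transpose * J * H) * Hi := by simp only [Matrix.mul_assoc]
      _ = J * Hi := by rw [hunit]
  have h2 : J * H = (Hi.map σ).transpose * J := by
    calc J * H = ((Hi.map σ).transpose * (H.map σ).transpose) * J * H := by
            rw [← Matrix.transpose_mul, hmapHHi, Matrix.transpose_one, Matrix.one_mul]
      _ = (Hi.map σ).transpose * ((H.map σ).transpose * J * H) := by simp only [Matrix.mul_assoc]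
      _ = (Hi.map σ).transpose * J := by rw [hunit]
  -- expand
  rw [Matrix.map_mul, Matrix.map_mul, Matrix.transpose_mul, Matrix.transpose_mul]
  calc (Hi.map σ).transpose * ((X.map σ).transpose * (H.map σ).transpose) * J + J * (H * X * Hi)
      = (Hi.map σ).transpose * (X.map σ).transpose * ((H.map σ).transpose * J) + (J * H) * X * Hi := by simp only [Matrix.mul_assoc]
    _ = (Hi.map σ).transpose * (X.map σ).transpose * (J * Hi) + ((Hi.map σ).transpose * J) * X * Hi := by rw [h1, h2]
    _ = (Hi.map σ).transpose * ((X.map σ).transpose * J + J * X) * Hi := by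
        simp only [Matrix.mul_add, Matrix.add_mul, Matrix.mul_assoc]
    _ = 0 := by rw [hX, Matrix.mul_zero, Matrix.zero_mul]

/-- The characteristic polynomial is `Ad(U)`-invariant. [cite: Rogawski1990, §3.1 p. 19] -/
theorem charpoly_conjAct (h : ↥(unitaryGroupOfForm σ J)) (X : Matrix (Fin n) (Fin n) K) :
    (((h : GL (Fin n) K) : Matrix (Fin n) (Fin n) K) * X * (((h⁻¹ : ↥(unitaryGroupOfForm σ J)) : GL (Fin n) K) : Matrix (Fin n) (Fin n) K)).charpoly = X.charpoly := by
  rw [InvMemClass.coe_inv, Matrix.coe_units_inv]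
  exact Matrix.charpoly_units_conj (h : GL (Fin n) K) X

variable [TopologicalSpace K]

/-- **Compactness of the centraliser is `Ad(U)`-invariant**: `{g | g (hXh⁻¹) g⁻¹ = hXh⁻¹}` is the image of `{g | gXg⁻¹ = X}` under the homeomorphism `g ↦ h g h⁻¹`.
[cite: HarishChandra1970, Part VI §8 p. 60] -/
theorem isCompact_centralizerSet_conjAct [IsTopologicalRing K] [T2Space K] (h : ↥(unitaryGroupOfForm σ J)) {X : Matrix (Fin n) (Fin n) K}
    (hc : IsCompact {g : ↥(unitaryGroupOfForm σ J) |
      ((g : GL (Fin n) K) : Matrix (Fin n) (Fin n) K) * X * (((g⁻¹ : ↥(unitaryGroupOfForm σ J)) : GL (Fin n) K) : Matrix (Fin n) (Fin n) K) = X}) :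
    IsCompact {g : ↥(unitaryGroupOfForm σ J) |
      ((g : GL (Fin n) K) : Matrix (Fin n) (Fin n) K) *
          (((h : GL (Fin n) K) : Matrix (Fin n) (Fin n) K) * X * (((h⁻¹ : ↥(unitaryGroupOfForm σ J)) : GL (Fin n) K) : Matrix (Fin n) (Fin n) K)) *
        (((g⁻¹ : ↥(unitaryGroupOfForm σ J)) : GL (Fin n) K) : Matrix (Fin n) (Fin n) K) =
      ((h : GL (Fin n) K) : Matrix (Fin n) (Fin n) K) * X * (((h⁻¹ : ↥(unitaryGroupOfForm σ J)) : GL (Fin n) K) : Matrix (Fin n) (Fin n) K)} := by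
  have hcont : Continuous fun g : ↥(unitaryGroupOfForm σ J) => h * g * h⁻¹ := (continuous_const.mul continuous_id).mul continuous_const
  refine (hc.image hcont).of_isClosed_subset ?_ ?_
  · -- closedness: the condition is a closed condition (matrix entries are continuous in `g`)
    have hc1 : Continuous fun g : ↥(unitaryGroupOfForm σ J) => ((g : GL (Fin n) K) : Matrix (Fin n) (Fin n) K) :=
      Units.continuous_val.comp continuous_subtype_val
    have hc2 : Continuous fun g : ↥(unitaryGroupOfForm σ J) => (((g⁻¹ : ↥(unitaryGroupOfForm σ J)) : GL (Fin n) K) : Matrix (Fin n) (Fin n) K) :=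
      hc1.comp continuous_inv
    exact isClosed_eq ((hc1.mul continuous_const).mul hc2) continuous_const
  · intro g hg
    refine ⟨h⁻¹ * g * h, ?_, by group⟩
    simp only [Set.mem_setOf_eq] at hg ⊢
    -- `(h⁻¹ g h) X (h⁻¹ g h)⁻¹ = h⁻¹ (g (h X h⁻¹) g⁻¹) h = h⁻¹ (h X h⁻¹) h = X`
    have e1 := conjAct_mul σ (h⁻¹ * g) h X
    have e2 := conjAct_mul σ h⁻¹ g ((((h : GL (Fin n) K) : Matrix (Fin n) (Fin n) K) * X *
      (((h⁻¹ : ↥(unitaryGroupOfForm σ J)) : GL (Fin n) K) : Matrix (Fin n) (Fin n) K)))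
    rw [e1, e2, hg, ← conjAct_mul σ h⁻¹ h X, inv_mul_cancel]
    simp

end Adjoint

/-! ## §3 The glue in the currency of the Lie letter `sig_K2E3HC13LieEllRankOne` (every `n`, every `J`) -/

section Glue

variable {K : Type*} [Field K] [Valued K ℤᵐ⁰] [ValuativeRel K] [(Valued.v : Valuation K ℤᵐ⁰).Compatible] [IsNonarchimedeanLocalField K]
  (σ : K →+* K) {n : ℕ} {J : Matrix (Fin n) (Fin n) K}
  [MeasurableSpace ↥(unitaryGroupOfForm σ J)] [BorelSpace ↥(unitaryGroupOfForm σ J)] (μ : Measure ↥(unitaryGroupOfForm σ J)) [μ.IsMulRightInvariant]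
  [MeasurableSpace (Matrix (Fin n) (Fin n) K)]

omit [(Valued.v : Valuation K ℤᵐ⁰).Compatible] in
/-- **LOCAL-UNIFORM AT EVERY POINT OF `S` ⇒ THE UNIFORM LIE LETTER** (road HC-14-ell, RULINGS #11 (R11-1)): if every `X₁ ∈ S` has a neighbourhood `V` and a constant
`C` such that `|discr χ_X|^r · ∫_U Θ(gXg⁻¹) dμ ≤ C · M` for all `Θ` vanishing off `S` bounded by `M` and all `X ∈ V ∩ 𝔲(σ,J)` with `discr χ_X ≠ 0` and compact
centraliser, then ONE constant serves all such `X` in `M_n(K)` — the conclusion of the lead's cand `sig_K2E3HC13LieEllRankOne` (there `n = 3`, `J = Φ₃`, `r = 1∕4`).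
`μ` is only assumed right invariant (`U` is unimodular).  [cite: HarishChandra1970, Part V §3 Theorem 13 p. 44; Part VI §8 p. 60] [cite: Rogawski1990, §7.3 p. 97] -/
theorem hc13Lie_uniform_of_local (r : ℝ) {S : Set (Matrix (Fin n) (Fin n) K)} (hS : IsCompact S)
    (hloc : ∀ X₁ ∈ S, ∃ V ∈ 𝓝 X₁, ∃ C : ℝ≥0, ∀ Θ : Matrix (Fin n) (Fin n) K → ℝ≥0∞, (∀ X, Θ X ≠ 0 → X ∈ S) → ∀ M : ℝ≥0∞, (∀ X, Θ X ≤ M) →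
      ∀ X ∈ V, ((X.map σ).transpose * J + J * X = 0 ∧ X.charpoly.discr ≠ 0 ∧
        IsCompact {g : ↥(unitaryGroupOfForm σ J) |
          ((g : GL (Fin n) K) : Matrix (Fin n) (Fin n) K) * X * (((g⁻¹ : ↥(unitaryGroupOfForm σ J)) : GL (Fin n) K) : Matrix (Fin n) (Fin n) K) = X}) →
        ((normAbs K X.charpoly.discr : ℝ≥0) : ℝ≥0∞) ^ r *
          ∫⁻ g, Θ (((g : GL (Fin n) K) : Matrix (Fin n) (Fin n) K) * X * (((g⁻¹ : ↥(unitaryGroupOfForm σ J)) : GL (Fin n) K) : Matrix (Fin n) (Fin n) K)) ∂μ ≤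
          C * M) :
    ∃ C : ℝ≥0, ∀ Θ : Matrix (Fin n) (Fin n) K → ℝ≥0∞, Measurable Θ → (∀ X, Θ X ≠ 0 → X ∈ S) → ∀ M : ℝ≥0∞, (∀ X, Θ X ≤ M) →
      ∀ X : Matrix (Fin n) (Fin n) K, (X.map σ).transpose * J + J * X = 0 → X.charpoly.discr ≠ 0 →
        IsCompact {g : ↥(unitaryGroupOfForm σ J) |
          ((g : GL (Fin n) K) : Matrix (Fin n) (Fin n) K) * X * (((g⁻¹ : ↥(unitaryGroupOfForm σ J)) : GL (Fin n) K) : Matrix (Fin n) (Fin n) K) = X} →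
          ((normAbs K X.charpoly.discr : ℝ≥0) : ℝ≥0∞) ^ r *
            ∫⁻ g, Θ (((g : GL (Fin n) K) : Matrix (Fin n) (Fin n) K) * X * (((g⁻¹ : ↥(unitaryGroupOfForm σ J)) : GL (Fin n) K) : Matrix (Fin n) (Fin n) K)) ∂μ ≤
            C * M := by
  -- the abstract glue with `act g X = gXg⁻¹`, `w = |discr χ|^r`, `P = (∈ 𝔲) ∧ regular ∧ compact centraliser`
  have hact : ∀ (g h : ↥(unitaryGroupOfForm σ J)) (X : Matrix (Fin n) (Fin n) K),
      (((g * h : ↥(unitaryGroupOfForm σ J)) : GL (Fin n) K) : Matrix (Fin n) (Fin n) K) * X *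
          ((((g * h : ↥(unitaryGroupOfForm σ J))⁻¹ : ↥(unitaryGroupOfForm σ J)) : GL (Fin n) K) : Matrix (Fin n) (Fin n) K) =
        ((g : GL (Fin n) K) : Matrix (Fin n) (Fin n) K) *
            (((h : GL (Fin n) K) : Matrix (Fin n) (Fin n) K) * X * (((h⁻¹ : ↥(unitaryGroupOfForm σ J)) : GL (Fin n) K) : Matrix (Fin n) (Fin n) K)) *
          (((g⁻¹ : ↥(unitaryGroupOfForm σ J)) : GL (Fin n) K) : Matrix (Fin n) (Fin n) K) := conjAct_mul σ
  obtain ⟨C, hC⟩ := exists_const_of_forall_exists_nhds μ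
    (fun (g : ↥(unitaryGroupOfForm σ J)) (X : Matrix (Fin n) (Fin n) K) =>
      ((g : GL (Fin n) K) : Matrix (Fin n) (Fin n) K) * X * (((g⁻¹ : ↥(unitaryGroupOfForm σ J)) : GL (Fin n) K) : Matrix (Fin n) (Fin n) K))
    hact (w := fun X => ((normAbs K X.charpoly.discr : ℝ≥0) : ℝ≥0∞) ^ r)
    (fun g X => by simp only [charpoly_conjAct])
    (P := fun X => (X.map σ).transpose * J + J * X = 0 ∧ X.charpoly.discr ≠ 0 ∧
      IsCompact {g : ↥(unitaryGroupOfForm σ J) |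
        ((g : GL (Fin n) K) : Matrix (Fin n) (Fin n) K) * X * (((g⁻¹ : ↥(unitaryGroupOfForm σ J)) : GL (Fin n) K) : Matrix (Fin n) (Fin n) K) = X})
    (fun g X hX => ⟨mem_lieU_conjAct σ g hX.1, by rw [charpoly_conjAct]; exact hX.2.1, isCompact_centralizerSet_conjAct σ g hX.2.2⟩)
    hS (fun X₁ hX₁ => by
      obtain ⟨V, hV, C, hC⟩ := hloc X₁ hX₁
      exact ⟨V, hV, C, fun Θ hΘ M hM X hXV hPX => hC Θ hΘ M hM X hXV hPX⟩)
  exact ⟨C, fun Θ _ hΘ M hM X h𝔲 hreg hell => hC Θ hΘ M hM X ⟨h𝔲, hreg, hell⟩⟩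

end Glue

/-! ## §4 The same glue at GROUP level (the letter `sig_K2E3HC14EllRankOne` itself), every `n`, every `J` -/

section GroupGlue

/-- **Compactness of the centraliser is conjugation invariant** (any topological group): `Z(hγh⁻¹) = h Z(γ) h⁻¹` is the image of `Z(γ)` under a homeomorphism.
[cite: HarishChandra1970, Part VI §8 p. 60] -/
theorem isCompact_centralizer_conj {G : Type*} [Group G] [TopologicalSpace G] [IsTopologicalGroup G] (h γ : G)
    (hc : IsCompact ((Subgroup.centralizer ({γ} : Set G) : Subgroup G) : Set G)) :
    IsCompact ((Subgroup.centralizer ({h * γ * h⁻¹} : Set G) : Subgroup G) : Set G) := by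
  have hcont : Continuous fun g : G => h * g * h⁻¹ := (continuous_const.mul continuous_id).mul continuous_const
  convert hc.image hcont using 1
  ext g
  simp only [SetLike.mem_coe, Subgroup.mem_centralizer_iff, Set.mem_singleton_iff, forall_eq, Set.mem_image]
  constructor
  · intro hg
    refine ⟨h⁻¹ * g * h, ?_, by group⟩
    calc γ * (h⁻¹ * g * h) = h⁻¹ * (h * γ * h⁻¹ * g) * h := by group
      _ = h⁻¹ * (g * (h * γ * h⁻¹)) * h := by rw [hg]
      _ = h⁻¹ * g * h * γ := by group
  · rintro ⟨g', hg', rfl⟩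
    calc h * γ * h⁻¹ * (h * g' * h⁻¹) = h * (γ * g') * h⁻¹ := by group
      _ = h * (g' * γ) * h⁻¹ := by rw [hg']
      _ = h * g' * h⁻¹ * (h * γ * h⁻¹) := by group

open Literature.NumberTheory.Rogawski1990 in
/-- **LOCAL-UNIFORM AT EVERY POINT OF `S` ⇒ THE UNIFORM GROUP LETTER** `sig_K2E3HC14EllRankOne` (every `n`, `J`; the weight is the line's frozen group token
`T(γ) = √√(|discr χ_γ| · |det γ|⁻²)`, conjugation invariant through `χ` and `det`; admissibility = `IsRegularElt` ∧ compact centraliser, conjugation invariant by the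
previous lemma): if every `γ₁ ∈ S` has a neighbourhood `V` and a `C` with `T(γ) · ∫_U Θ(x γ x⁻¹) dμ ≤ C · M` for all admissible `γ ∈ V` and all `Θ` vanishing off `S`
bounded by `M`, then ONE constant serves all admissible `γ ∈ U`.  So the road may equally be run at GROUP level (local statements near regular points: ★ (f-i)
p856907; near singular semisimple points: descent to `Z(γ₁)`; near central points: germs) with no Cayley transport at all.
[cite: HarishChandra1970, Part VI §8 Theorem 14 p. 60; Part VII §3 Theorem 19 p. 70] [cite: Rogawski1990, §7.3 p. 97] -/
theorem hc14Ell_uniform_of_local {K : Type*} [Field K] [Valued K ℤᵐ⁰] [ValuativeRel K] [IsNonarchimedeanLocalField K]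
    (σ : K →+* K) {n : ℕ} {J : Matrix (Fin n) (Fin n) K}
    [MeasurableSpace ↥(unitaryGroupOfForm σ J)] [BorelSpace ↥(unitaryGroupOfForm σ J)] (μ : Measure ↥(unitaryGroupOfForm σ J)) [μ.IsMulRightInvariant]
    {S : Set ↥(unitaryGroupOfForm σ J)} (hS : IsCompact S)
    (hloc : ∀ γ₁ ∈ S, ∃ V ∈ 𝓝 γ₁, ∃ C : ℝ≥0, ∀ Θ : ↥(unitaryGroupOfForm σ J) → ℝ≥0∞, (∀ g, Θ g ≠ 0 → g ∈ S) → ∀ M : ℝ≥0∞, (∀ g, Θ g ≤ M) →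
      ∀ γ ∈ V, (IsRegularElt (γ : GL (Fin n) K) ∧
        IsCompact ((Subgroup.centralizer ({γ} : Set ↥(unitaryGroupOfForm σ J))) : Set ↥(unitaryGroupOfForm σ J))) →
        ((NNReal.sqrt (NNReal.sqrt
            (normAbs K (((γ : GL (Fin n) K) : Matrix (Fin n) (Fin n) K)).charpoly.discr *
              (normAbs K (((γ : GL (Fin n) K) : Matrix (Fin n) (Fin n) K)).det ^ 2)⁻¹)) : ℝ≥0) : ℝ≥0∞) *
          ∫⁻ x, Θ (x * γ * x⁻¹) ∂μ ≤ C * M) :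
    ∃ C : ℝ≥0, ∀ Θ : ↥(unitaryGroupOfForm σ J) → ℝ≥0∞, Measurable Θ → (∀ g, Θ g ≠ 0 → g ∈ S) → ∀ M : ℝ≥0∞, (∀ g, Θ g ≤ M) →
      ∀ γ : ↥(unitaryGroupOfForm σ J), IsRegularElt (γ : GL (Fin n) K) →
        IsCompact ((Subgroup.centralizer ({γ} : Set ↥(unitaryGroupOfForm σ J))) : Set ↥(unitaryGroupOfForm σ J)) →
          ((NNReal.sqrt (NNReal.sqrt
              (normAbs K (((γ : GL (Fin n) K) : Matrix (Fin n) (Fin n) K)).charpoly.discr *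
                (normAbs K (((γ : GL (Fin n) K) : Matrix (Fin n) (Fin n) K)).det ^ 2)⁻¹)) : ℝ≥0) : ℝ≥0∞) *
            ∫⁻ x, Θ (x * γ * x⁻¹) ∂μ ≤ C * M := by
  -- conjugation invariance of `χ` and `det` through `GL`
  have hcoe : ∀ h γ : ↥(unitaryGroupOfForm σ J), (((h * γ * h⁻¹ : ↥(unitaryGroupOfForm σ J)) : GL (Fin n) K) : Matrix (Fin n) (Fin n) K) =
      ((h : GL (Fin n) K) : Matrix (Fin n) (Fin n) K) * ((γ : GL (Fin n) K) : Matrix (Fin n) (Fin n) K) *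
        (((h : GL (Fin n) K)⁻¹ : GL (Fin n) K) : Matrix (Fin n) (Fin n) K) := fun h γ => by
    simp only [Subgroup.coe_mul, InvMemClass.coe_inv, Units.val_mul]
  have hchar : ∀ h γ : ↥(unitaryGroupOfForm σ J), (((h * γ * h⁻¹ : ↥(unitaryGroupOfForm σ J)) : GL (Fin n) K) : Matrix (Fin n) (Fin n) K).charpoly =
      (((γ : GL (Fin n) K) : Matrix (Fin n) (Fin n) K)).charpoly := fun h γ => by
    rw [hcoe, Matrix.coe_units_inv]; exact Matrix.charpoly_units_conj (h : GL (Fin n) K) _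
  have hdet : ∀ h γ : ↥(unitaryGroupOfForm σ J), (((h * γ * h⁻¹ : ↥(unitaryGroupOfForm σ J)) : GL (Fin n) K) : Matrix (Fin n) (Fin n) K).det =
      (((γ : GL (Fin n) K) : Matrix (Fin n) (Fin n) K)).det := fun h γ => by
    rw [hcoe]; exact Matrix.det_units_conj (h : GL (Fin n) K) _
  obtain ⟨C, hC⟩ := exists_const_of_forall_exists_nhds μ (fun (g γ : ↥(unitaryGroupOfForm σ J)) => g * γ * g⁻¹) (fun g h γ => by group)
    (w := fun γ => ((NNReal.sqrt (NNReal.sqrt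
            (normAbs K (((γ : GL (Fin n) K) : Matrix (Fin n) (Fin n) K)).charpoly.discr *
              (normAbs K (((γ : GL (Fin n) K) : Matrix (Fin n) (Fin n) K)).det ^ 2)⁻¹)) : ℝ≥0) : ℝ≥0∞))
    (fun g γ => by simp only [hchar, hdet])
    (P := fun γ => IsRegularElt (γ : GL (Fin n) K) ∧
      IsCompact ((Subgroup.centralizer ({γ} : Set ↥(unitaryGroupOfForm σ J))) : Set ↥(unitaryGroupOfForm σ J)))
    (fun g γ hγ => ⟨by rw [isRegularElt_iff, hchar]; exact (isRegularElt_iff _).1 hγ.1, isCompact_centralizer_conj g γ hγ.2⟩)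
    hS (fun γ₁ hγ₁ => by
      obtain ⟨V, hV, C, hC⟩ := hloc γ₁ hγ₁
      exact ⟨V, hV, C, fun Θ hΘ M hM γ hγV hPγ => hC Θ hΘ M hM γ hγV hPγ⟩)
  exact ⟨C, fun Θ _ hΘ M hM γ hreg hell => hC Θ hΘ M hM γ ⟨hreg, hell⟩⟩

end GroupGlue

end Summit.HodgeConjecture.HodgeConjecture.Cruxes.H413.K2E3HC14EllLocalToUniform

end
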